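import Summits.CriticalPhenomena.CardyFormulaZ2.Theses.CardySelfRefinement
import Summits.CriticalPhenomena.CardyFormulaZ2.Theses.CardyComplexCone
import Summits.CriticalPhenomena.CardyFormulaZ2.Theorems.SLE6LimitZ2AllDiscretisations
import Literature.Probability.Percolation.InterfaceScalingLimitDiscretised
import HarnessLib

/-!
# `InterfaceToCardy` (stmt-CriticalPhenomena-10278): identification with its twins

Route `CardySelfRefinement`, sub-problem `CriticalPhenomena/CardyFormulaZ2`, support item
`Summit.CriticalPhenomena.CardyFormulaZ2.Theses.CardySelfRefinement.InterfaceToCardy`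
("SLE₆ for every Dobrushin domain and every admissible `ℤ²`-discretisation family ⇒ Cardy's
formula for bond percolation on `ℤ²`").  The antecedent of the item is, verbatim, the body of the
conjecture leaf `Summit.CriticalPhenomena.CardyFormulaZ2.SLE6LimitZ2AllDiscretisations`, and the
item is the same proposition as the crux `SLESixFamiliesGiveCardy` of route `CardyComplexCone`
(stmt-CriticalPhenomena-9654), whose antecedent spells the six fields of
`ZdDiscretisationFamily` and the endpoint rule `orientCurve` of `bondInterfaceIn` inline.

This helper file records these identifications as theorems, so that a proof of any one of the
three statements closes the other two by a one-line term:

* `interfaceToCardy_iff_of_conjecture` —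
  `InterfaceToCardy ↔ (SLE6LimitZ2AllDiscretisations → CardyFormulaZ2)` (definitional);
* `interfaceToCardy_iff_slesixFamiliesGiveCardy` — `InterfaceToCardy ↔ SLESixFamiliesGiveCardy`
  (bundle/unbundle the six fields of `ZdDiscretisationFamily`; the two interface maps agree by
  `rfl`), with the two one-directional corollaries
  `interfaceToCardy_of_slesixFamiliesGiveCardy`, `slesixFamiliesGiveCardy_of_interfaceToCardy`.
-/

noncomputable section

open MeasureTheory Filter Topology
open scoped unitInterval

namespace Summit.CriticalPhenomena.CardyFormulaZ2.Theorems.InterfaceToCardyBridge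

open Literature.Probability.RandomPlanarGeometry Literature.Probability.LatticeModels

/-- `InterfaceToCardy` is, definitionally, the implication "conjecture leaf
`SLE6LimitZ2AllDiscretisations` ⇒ `CardyFormulaZ2`" (the form of the twin item
stmt-CriticalPhenomena-8603 of route `CardyRotToConf`). [folklore] -/
theorem interfaceToCardy_iff_of_conjecture :
    Theses.CardySelfRefinement.InterfaceToCardy ↔
      (Summit.CriticalPhenomena.CardyFormulaZ2.SLE6LimitZ2AllDiscretisations →
        _root_.CardyFormulaZ2) :=
  Iff.rfl

/-- **`InterfaceToCardy ↔ SLESixFamiliesGiveCardy`**: the support item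
stmt-CriticalPhenomena-10278 of route `CardySelfRefinement` and the crux
stmt-CriticalPhenomena-9654 of route `CardyComplexCone` are the same proposition —
`ZdDiscretisationFamily D E` is the conjunction of the six unbundled hypotheses of the crux, and
the two interface maps agree pointwise by `rfl` (`bondInterfaceIn`, `orientCurve`, `reverseCurve`
unfold to the crux's inline `if`/`comp`). [folklore] -/
theorem interfaceToCardy_iff_slesixFamiliesGiveCardy :
    Theses.CardySelfRefinement.InterfaceToCardy ↔
      Theses.CardyComplexCone.SLESixFamiliesGiveCardy := by
  constructor
  · intro h H
    refine h fun D E hE => ?_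
    exact H D E hE.Ω_eq hE.δ_eq hE.tendsto_arcA hE.tendsto_arcB hE.tendsto_zdABEdges
      hE.eventually_isZdAdmissible
  · intro h H
    refine h fun D Λ h₁ h₂ h₃ h₄ h₅ h₆ => ?_
    exact H D Λ ⟨h₁, h₂, h₃, h₄, h₅, h₆⟩

/-- A proof of the crux `SLESixFamiliesGiveCardy` (stmt-CriticalPhenomena-9654) proves
`InterfaceToCardy` (stmt-CriticalPhenomena-10278). [folklore] -/
theorem interfaceToCardy_of_slesixFamiliesGiveCardy
    (h : Theses.CardyComplexCone.SLESixFamiliesGiveCardy) :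
    Theses.CardySelfRefinement.InterfaceToCardy :=
  interfaceToCardy_iff_slesixFamiliesGiveCardy.2 h

/-- Conversely, a proof of `InterfaceToCardy` proves the crux `SLESixFamiliesGiveCardy`.
[folklore] -/
theorem slesixFamiliesGiveCardy_of_interfaceToCardy
    (h : Theses.CardySelfRefinement.InterfaceToCardy) :
    Theses.CardyComplexCone.SLESixFamiliesGiveCardy :=
  interfaceToCardy_iff_slesixFamiliesGiveCardy.1 h

end Summit.CriticalPhenomena.CardyFormulaZ2.Theorems.InterfaceToCardyBridge

end
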